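import Summits.BirchSwinnertonDyer.BirchSwinnertonDyer.Theorems.Rank2Observatory2DescKillSig2CVal
import HarnessLib

/-!
# KERNEL-2DESC — the 2-adic signature kill at a CUBIC place, PART 3a of 3: driver lemmas (cert-1 g40)

The case analysis of PART 3b (`…Sig2C`) on a primitive zero `(r, n)` of `killQ` runs on the congruence
`Q² ≡ w₀·Z − n²·(Z·T) (mod 2^N)`, `Q = Z·R` (`E` below).  This file supplies its ingredients, all elementary:
* `exists_two_pow_mul_odd`, `exists_inv_two_pow`, `eight_dvd_sq_sub_one` — 2-adic bookkeeping in `ℤ`;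
* `strip_pow` — `S² ≡ 4^τ·X (mod 2^M)` forces `S'² ≡ X (mod 2^(M−2τ))` (iterated strip lemma of PART 2);
* `exists_content`, `content_bound`, `content_ZRR` — the CONTENT BOUND: if `Z = 2^cZ·Z̄`, `Z̄ ≢ 0 (mod 2)` and
  `2^(δ+1) ∤ R` then `2^(B+1) ∤ Z·R²` with `B = cZ + 2δ + 2` (R) / `cZ + 2δ` (U) — this bounds `v₂(n)` on the
  integral side and `v₂(w₀)` on the pattern side, and excludes `w₀ = n = 0`;
* `cX`, `sig2cLeaf`, `sig2cPat` (the leaf and the pattern block of the checker) with `leaf_sound2c` and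
  `pat_contra` — every use of the non-square test `nonsqT` goes through `nonsqT_sound`.

HONEST FRAMING: per-curve certified theorems and census instruments; no claim on BSD in rank ≥ 2.
[cite: CremonaAlgorithms1997, §3.6] [cite: Cassels1991LecturesEllipticCurves, §15] [cite: Cohen1993, §4.8.2]
-/

set_option linter.dupNamespace false

namespace Summit.BirchSwinnertonDyer.BirchSwinnertonDyer.Rank2Observatory.TwoDescKill

/-! ### Integer bookkeeping -/

/-- `w ≠ 0` is `2^k · u` with `u` odd. [folklore] -/
theorem exists_two_pow_mul_odd : ∀ (m : ℕ) (w : ℤ), w ≠ 0 → w.natAbs ≤ m →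
    ∃ k : ℕ, ∃ u : ℤ, w = (2 : ℤ) ^ k * u ∧ ¬ (2 : ℤ) ∣ u
  | 0, w, hw, hm => absurd (Int.natAbs_eq_zero.mp (Nat.le_zero.mp hm)) hw
  | m + 1, w, hw, hm => by
      by_cases h2 : (2 : ℤ) ∣ w
      · obtain ⟨w', rfl⟩ := h2
        have hw' : w' ≠ 0 := by rintro rfl; simp at hw
        have hm' : w'.natAbs ≤ m := by
          have := Int.natAbs_mul 2 w'
          simp only [Int.reduceAbs] at this  -- |2 w'| = 2 |w'|
          have hpos : 0 < w'.natAbs := Int.natAbs_pos.mpr hw'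
          omega
        obtain ⟨k, u, hk, hu⟩ := exists_two_pow_mul_odd m w' hw' hm'
        exact ⟨k + 1, u, by rw [hk, pow_succ]; ring, hu⟩
      · exact ⟨0, w, by simp, h2⟩

/-- An odd integer is invertible mod `2^N`. [folklore] -/
theorem exists_inv_two_pow {n : ℤ} (hn : ¬ (2 : ℤ) ∣ n) (N : ℕ) : ∃ ι : ℤ, ι * n ≡ 1 [ZMOD (2 : ℤ) ^ N] := by
  obtain ⟨m, k, hmk⟩ : IsCoprime n ((2 : ℤ) ^ N) :=
    ((Prime.coprime_iff_not_dvd Int.prime_two).mpr hn).symm.pow_right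
  exact ⟨m, Int.modEq_iff_dvd.mpr ⟨k, by linear_combination (-1 : ℤ) * hmk⟩⟩

/-- `8 ∣ n² − 1` for odd `n`. [folklore] -/
theorem eight_dvd_sq_sub_one {n : ℤ} (hn : ¬ (2 : ℤ) ∣ n) : (8 : ℤ) ∣ n ^ 2 - 1 := by
  have h1 : n % 2 = 1 := by omega
  obtain ⟨m, hm⟩ : ∃ m, n = 2 * m + 1 := ⟨n / 2, by omega⟩
  obtain ⟨j, hj⟩ := Int.even_mul_succ_self m
  exact ⟨j, by rw [hm]; linear_combination (4 : ℤ) * hj⟩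

/-- Cancelling `2^i` from a congruence mod `2^(M+i)`. [folklore] -/
theorem modEq_cancel_pow {i M : ℕ} {a b : ℤ} (h : (2 : ℤ) ^ i * a ≡ (2 : ℤ) ^ i * b [ZMOD (2 : ℤ) ^ (M + i)]) :
    a ≡ b [ZMOD (2 : ℤ) ^ M] := by
  have := Int.modEq_iff_dvd.mp h
  rw [← mul_sub, pow_add, mul_comm ((2 : ℤ) ^ M)] at this
  exact Int.modEq_iff_dvd.mpr ((mul_dvd_mul_iff_left (pow_ne_zero _ (by norm_num))).mp this)

/-- `CME` under a common scalar. [folklore] -/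
theorem CME.csc {m : ℤ} (k : ℤ) {A B : ℤ × ℤ × ℤ} (h : CME m A B) : CME m (csc k A) (csc k B) := by
  simp only [CME, TwoDescKill.csc]
  exact ⟨h.1.mul_left k, h.2.1.mul_left k, h.2.2.mul_left k⟩

/-- Cancelling `2^i` from a triple congruence mod `2^(M+i)`. [folklore] -/
theorem CME_cancel_pow {i M : ℕ} {A B : ℤ × ℤ × ℤ}
    (h : CME ((2 : ℤ) ^ (M + i)) (csc ((2 : ℤ) ^ i) A) (csc ((2 : ℤ) ^ i) B)) : CME ((2 : ℤ) ^ M) A B := by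
  simp only [CME, TwoDescKill.csc] at h
  exact ⟨modEq_cancel_pow h.1, modEq_cancel_pow h.2.1, modEq_cancel_pow h.2.2⟩

/-- `CME` is reflexive. [folklore] -/
theorem CME.rfl {m : ℤ} {A : ℤ × ℤ × ℤ} : CME m A A := ⟨Int.ModEq.refl _, Int.ModEq.refl _, Int.ModEq.refl _⟩

/-- Divisibility of all coordinates passes along `CME`. [folklore] -/
theorem dvd_of_CME {m : ℤ} {A B : ℤ × ℤ × ℤ} (h : CME m A B) (hB : m ∣ B.1 ∧ m ∣ B.2.1 ∧ m ∣ B.2.2) :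
    m ∣ A.1 ∧ m ∣ A.2.1 ∧ m ∣ A.2.2 :=
  ⟨Int.modEq_zero_iff_dvd.mp (h.1.trans (Int.modEq_zero_iff_dvd.mpr hB.1)),
    Int.modEq_zero_iff_dvd.mp (h.2.1.trans (Int.modEq_zero_iff_dvd.mpr hB.2.1)),
    Int.modEq_zero_iff_dvd.mp (h.2.2.trans (Int.modEq_zero_iff_dvd.mpr hB.2.2))⟩

/-! ### Algebraic identities -/

/-- `(Z·R)² = Z·(Z·R²)`. [folklore] -/
theorem cmul_sq_ZR (m₁ m₀ : ℤ) (Z R : ℤ × ℤ × ℤ) :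
    cmul m₁ m₀ (cmul m₁ m₀ Z R) (cmul m₁ m₀ Z R) = cmul m₁ m₀ Z (cmul m₁ m₀ Z (cmul m₁ m₀ R R)) := by
  rw [cmul_assoc, ← cmul_assoc m₁ m₀ R Z R, cmul_comm m₁ m₀ R Z, cmul_assoc]

/-- `Z·(w + q·T) = w·Z + q·(Z·T)`. [folklore] -/
theorem cmul_lin (m₁ m₀ : ℤ) (Z T : ℤ × ℤ × ℤ) (w q : ℤ) :
    cmul m₁ m₀ Z (cadd (w, 0, 0) (csc q T)) = cadd (csc w Z) (csc q (cmul m₁ m₀ Z T)) := by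
  simp only [cmul, cadd, csc]; ext <;> ring

/-- The pattern / leaf triple `c·Z − (Z·T)·s` as a function of the two scalars. [folklore] -/
def cPat (Z ZT : ℤ × ℤ × ℤ) (α β : ℤ) : ℤ × ℤ × ℤ := cadd (csc α Z) (csc β ZT)

/-- The leaf triple `X(c) = c·Z − Z·T` (the image of `z·(c − θ_T)`). [folklore] -/
def cX (Z ZT : ℤ × ℤ × ℤ) (c : ℤ) : ℤ × ℤ × ℤ := cPat Z ZT c (-1)

/-- Scalars pull into the pattern triple. [folklore] -/
theorem csc_cPat (Z ZT : ℤ × ℤ × ℤ) (k α β : ℤ) : csc k (cPat Z ZT α β) = cPat Z ZT (k * α) (k * β) := by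
  simp only [cPat, cadd, csc]; ext <;> ring

/-- `Z·(w − q·T) = w·Z − q·(Z·T)` in the shape delivered by `root_rel₃`. [folklore] -/
theorem cmul_lin' (m₁ m₀ : ℤ) (Z T : ℤ × ℤ × ℤ) (w q : ℤ) :
    cmul m₁ m₀ Z (w - q * T.1, -(q * T.2.1), -(q * T.2.2)) = cPat Z (cmul m₁ m₀ Z T) w (-q) := by
  simp only [cmul, cPat, cadd, csc]; ext <;> ring

/-- Two pattern triples whose scalars agree mod `2^m`, over `Z, ZT ≡ 0 (mod 2^cZ)`, agree mod `2^(m + cZ)`. [folklore] -/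
theorem cPat_congr {Z ZT Zb ZTb : ℤ × ℤ × ℤ} {cZ m : ℕ} (hZ : Z = csc ((2 : ℤ) ^ cZ) Zb)
    (hZT : ZT = csc ((2 : ℤ) ^ cZ) ZTb) {α α' β β' : ℤ} (hα : (2 : ℤ) ^ m ∣ α - α') (hβ : (2 : ℤ) ^ m ∣ β - β') :
    CME ((2 : ℤ) ^ (m + cZ)) (cPat Z ZT α β) (cPat Z ZT α' β') := by
  obtain ⟨x, hx⟩ := hα
  obtain ⟨y, hy⟩ := hβ
  have eα : α = α' + 2 ^ m * x := by linarith
  have eβ : β = β' + 2 ^ m * y := by linarith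
  subst hZ hZT
  simp only [cPat, cadd, csc, CME]
  refine ⟨Int.modEq_iff_dvd.mpr ⟨-(x * Zb.1 + y * ZTb.1), ?_⟩,
    Int.modEq_iff_dvd.mpr ⟨-(x * Zb.2.1 + y * ZTb.2.1), ?_⟩, Int.modEq_iff_dvd.mpr ⟨-(x * Zb.2.2 + y * ZTb.2.2), ?_⟩⟩
  · rw [eα, eβ, pow_add]; ring
  · rw [eα, eβ, pow_add]; ring
  · rw [eα, eβ, pow_add]; ring

/-! ### Stripping powers of 4 -/

/-- **Iterated strip.** `S² ≡ 4^τ·X (mod 2^M)` with `2τ ≤ M` gives `S'² ≡ X (mod 2^(M − 2τ))`. [folklore] -/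
theorem strip_pow (ram : Bool) (X : ℤ × ℤ × ℤ) : ∀ (τ M : ℕ) (S : ℤ × ℤ × ℤ), 2 * τ ≤ M →
    CME ((2 : ℤ) ^ M) (cmul (tm₁ ram) (tm₀ ram) S S) (csc ((2 : ℤ) ^ (2 * τ)) X) →
    ∃ S' : ℤ × ℤ × ℤ, CME ((2 : ℤ) ^ (M - 2 * τ)) (cmul (tm₁ ram) (tm₀ ram) S' S') X
  | 0, M, S, _, h => ⟨S, by simpa [csc] using h⟩
  | τ + 1, M, S, hτ, h => by
      -- `S² ≡ 0 (mod 4)`: strip once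
      have h4 : (4 : ℤ) ∣ (2 : ℤ) ^ M := by
        rw [show (4 : ℤ) = 2 ^ 2 by norm_num]; exact pow_dvd_pow 2 (by omega)
      have hz : czero4 (csc ((2 : ℤ) ^ (2 * (τ + 1))) X) = true := by
        have e : (2 : ℤ) ^ (2 * (τ + 1)) = 4 * 2 ^ (2 * τ) := by
          rw [show 2 * (τ + 1) = 2 * τ + 2 by ring, pow_add]; ring
        simp only [czero4, csc, e, Bool.and_eq_true, beq_iff_eq]
        refine ⟨⟨?_, ?_⟩, ?_⟩ <;> simp [mul_assoc]
      have hsq : czero4 (cmul (tm₁ ram) (tm₀ ram) S S) = true := by rwa [czero4_congr h4 h]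
      obtain ⟨S₁, rfl⟩ := even_of_sq_zero4 ram hsq
      rw [cmul_csc_csc] at h
      -- cancel `4 = 2^2`
      have hM : M = (M - 2) + 2 := by omega
      have e4 : (2 : ℤ) * 2 = 2 ^ 2 := by norm_num
      have eX : csc ((2 : ℤ) ^ (2 * (τ + 1))) X = csc ((2 : ℤ) ^ 2) (csc ((2 : ℤ) ^ (2 * τ)) X) := by
        rw [csc_csc, ← pow_add]; congr 1; ring
      rw [hM, e4, eX] at h
      have h' := CME_cancel_pow h
      obtain ⟨S', hS'⟩ := strip_pow ram X τ (M - 2) S₁ (by omega) h'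
      exact ⟨S', by rwa [show M - 2 * (τ + 1) = M - 2 - 2 * τ by omega]⟩

/-! ### Contents -/

/-- A triple not divisible by `2^(δ+1)` is `2^c · R̄` with `c ≤ δ` and `R̄ ≢ 0 (mod 2)`. [folklore] -/
theorem exists_content : ∀ (δ : ℕ) (R : ℤ × ℤ × ℤ),
    ¬ ((2 : ℤ) ^ (δ + 1) ∣ R.1 ∧ (2 : ℤ) ^ (δ + 1) ∣ R.2.1 ∧ (2 : ℤ) ^ (δ + 1) ∣ R.2.2) →
    ∃ c : ℕ, ∃ Rb : ℤ × ℤ × ℤ, c ≤ δ ∧ R = csc ((2 : ℤ) ^ c) Rb ∧ czero2 Rb = false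
  | δ, R, h => by
      by_cases h2 : czero2 R = true
      · simp only [czero2, Bool.and_eq_true, beq_iff_eq] at h2
        obtain ⟨⟨e₁, e₂⟩, e₃⟩ := h2
        obtain ⟨d₁, hd₁⟩ := Int.dvd_of_emod_eq_zero e₁
        obtain ⟨d₂, hd₂⟩ := Int.dvd_of_emod_eq_zero e₂
        obtain ⟨d₃, hd₃⟩ := Int.dvd_of_emod_eq_zero e₃
        cases δ with
        | zero => exact absurd ⟨⟨d₁, by simpa using hd₁⟩, ⟨d₂, by simpa using hd₂⟩, ⟨d₃, by simpa using hd₃⟩⟩ h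
        | succ δ =>
            have h' : ¬ ((2 : ℤ) ^ (δ + 1) ∣ d₁ ∧ (2 : ℤ) ^ (δ + 1) ∣ d₂ ∧ (2 : ℤ) ^ (δ + 1) ∣ d₃) := by
              rintro ⟨k₁, k₂, k₃⟩
              refine h ⟨?_, ?_, ?_⟩
              · rw [hd₁, pow_succ, mul_comm]; exact mul_dvd_mul_left 2 k₁ |>.trans (by rw [mul_comm])
              · rw [hd₂, pow_succ, mul_comm]; exact mul_dvd_mul_left 2 k₂ |>.trans (by rw [mul_comm])
              · rw [hd₃, pow_succ, mul_comm]; exact mul_dvd_mul_left 2 k₃ |>.trans (by rw [mul_comm])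
            obtain ⟨c, Rb, hc, hR, hRb⟩ := exists_content δ (d₁, d₂, d₃) h'
            refine ⟨c + 1, Rb, by omega, ?_, hRb⟩
            have : R = csc 2 (d₁, d₂, d₃) := by simp only [csc]; ext <;> simp only <;> assumption
            rw [this, hR, csc_csc, pow_succ, mul_comm]
      · exact ⟨0, R, Nat.zero_le _, by simp [csc], by simpa using h2⟩

/-- **Content of `Z̄·R̄²`** for `Z̄, R̄ ≢ 0 (mod 2)`: not `≡ 0 (mod 8)` (R) / not `≡ 0 (mod 2)` (U). [folklore] -/
theorem content_bound (ram : Bool) {Zb Rb : ℤ × ℤ × ℤ} (hZ : czero2 Zb = false) (hR : czero2 Rb = false) :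
    let Y := cmul (tm₁ ram) (tm₀ ram) Zb (cmul (tm₁ ram) (tm₀ ram) Rb Rb)
    ¬ ((2 : ℤ) ^ (if ram then 3 else 1) ∣ Y.1 ∧ (2 : ℤ) ^ (if ram then 3 else 1) ∣ Y.2.1 ∧
        (2 : ℤ) ^ (if ram then 3 else 1) ∣ Y.2.2) := by
  intro Y hY
  have hRR := prod_content ram hR hR
  cases ram
  · simp only [Bool.false_eq_true, ↓reduceIte, pow_one] at hRR hY
    have h2 := prod_content false hZ hRR
    simp only [Bool.false_eq_true, ↓reduceIte, czero2, Bool.and_eq_false_iff, beq_eq_false_iff_ne, ne_eq] at h2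
    obtain ⟨⟨k₁, hk₁⟩, ⟨k₂, hk₂⟩, ⟨k₃, hk₃⟩⟩ := hY
    simp only [Y] at hk₁ hk₂ hk₃
    rcases h2 with (h2 | h2) | h2 <;> omega
  · simp only [↓reduceIte] at hRR hY
    set P := cmul (tm₁ true) (tm₀ true) Rb Rb with hP
    by_cases hP2 : czero2 P = true
    · -- `P = 2·P'`, `P' ≢ 0 (mod 2)` (else `P ≡ 0 (mod 4)`), and `Z̄·P' ≢ 0 (mod 4)`
      simp only [czero2, Bool.and_eq_true, beq_iff_eq] at hP2
      obtain ⟨⟨e₁, e₂⟩, e₃⟩ := hP2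
      set P' : ℤ × ℤ × ℤ := (P.1 / 2, P.2.1 / 2, P.2.2 / 2) with hP'
      have hPP : P = csc 2 P' := by simp only [csc, hP']; ext <;> simp only <;> omega
      have hP'2 : czero2 P' = false := by
        by_contra hc
        simp only [Bool.not_eq_false, czero2, Bool.and_eq_true, beq_iff_eq, hP'] at hc
        simp only [czero4, Bool.and_eq_false_iff, beq_eq_false_iff_ne, ne_eq] at hRR
        rcases hRR with (h | h) | h <;> omega
      have h4 := prod_content true hZ hP'2
      simp only [↓reduceIte, czero4, Bool.and_eq_false_iff, beq_eq_false_iff_ne, ne_eq] at h4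
      have hYe : Y = csc 2 (cmul (tm₁ true) (tm₀ true) Zb P') := by
        simp only [Y]; rw [← hP, hPP, cmul_csc]
      obtain ⟨⟨k₁, hk₁⟩, ⟨k₂, hk₂⟩, ⟨k₃, hk₃⟩⟩ := hY
      rw [hYe] at hk₁ hk₂ hk₃
      simp only [csc] at hk₁ hk₂ hk₃
      rcases h4 with (h | h) | h <;> omega
    · have h4 := prod_content true hZ (by simpa using hP2)
      simp only [↓reduceIte, czero4, Bool.and_eq_false_iff, beq_eq_false_iff_ne, ne_eq] at h4
      obtain ⟨⟨k₁, hk₁⟩, ⟨k₂, hk₂⟩, ⟨k₃, hk₃⟩⟩ := hY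
      simp only [Y] at hk₁ hk₂ hk₃
      rw [← hP] at hk₁ hk₂ hk₃
      rcases h4 with (h | h) | h <;> omega

/-- The content bound exponent `B = cZ + 2δ + 2` (R) / `cZ + 2δ` (U). [folklore] -/
def cB (ram : Bool) (cZ δ : ℕ) : ℕ := cZ + 2 * δ + (if ram then 2 else 0)

/-- **Content bound**: `Z = 2^cZ·Z̄`, `Z̄ ≢ 0 (mod 2)`, `2^(δ+1) ∤ R` ⇒ `2^(B+1) ∤ Z·(Z'·R²)`-free form:
`2^(B+1)` does not divide all coordinates of `Z·R²`. [folklore] -/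
theorem content_ZRR (ram : Bool) {Z Zb R : ℤ × ℤ × ℤ} {cZ δ : ℕ} (hZ : Z = csc ((2 : ℤ) ^ cZ) Zb)
    (hZb : czero2 Zb = false)
    (hR : ¬ ((2 : ℤ) ^ (δ + 1) ∣ R.1 ∧ (2 : ℤ) ^ (δ + 1) ∣ R.2.1 ∧ (2 : ℤ) ^ (δ + 1) ∣ R.2.2)) :
    let Y := cmul (tm₁ ram) (tm₀ ram) Z (cmul (tm₁ ram) (tm₀ ram) R R)
    ¬ ((2 : ℤ) ^ (cB ram cZ δ + 1) ∣ Y.1 ∧ (2 : ℤ) ^ (cB ram cZ δ + 1) ∣ Y.2.1 ∧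
        (2 : ℤ) ^ (cB ram cZ δ + 1) ∣ Y.2.2) := by
  intro Y hY
  obtain ⟨c, Rb, hc, hRe, hRb⟩ := exists_content δ R hR
  have hYe : Y = csc ((2 : ℤ) ^ (cZ + 2 * c)) (cmul (tm₁ ram) (tm₀ ram) Zb (cmul (tm₁ ram) (tm₀ ram) Rb Rb)) := by
    simp only [Y]; rw [hZ, hRe, cmul_csc_csc, cmul_csc, cmul_comm _ _ (csc _ Zb), cmul_csc, cmul_comm _ _ _ Zb,
      csc_csc]; congr 1; rw [← pow_add, ← pow_add]; congr 1; ring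
  set e := (if ram then 3 else 1 : ℕ) with he
  have hle : cZ + 2 * c + e ≤ cB ram cZ δ + 1 := by
    simp only [cB, he]; cases ram <;> simp <;> omega
  refine content_bound ram hZb hRb ⟨?_, ?_, ?_⟩
  · have := (pow_dvd_pow (2 : ℤ) hle).trans hY.1
    rw [hYe, pow_add] at this; simp only [csc] at this
    exact (mul_dvd_mul_iff_left (pow_ne_zero _ (by norm_num))).mp this
  · have := (pow_dvd_pow (2 : ℤ) hle).trans hY.2.1
    rw [hYe, pow_add] at this; simp only [csc] at this
    exact (mul_dvd_mul_iff_left (pow_ne_zero _ (by norm_num))).mp this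
  · have := (pow_dvd_pow (2 : ℤ) hle).trans hY.2.2
    rw [hYe, pow_add] at this; simp only [csc] at this
    exact (mul_dvd_mul_iff_left (pow_ne_zero _ (by norm_num))).mp this

/-! ### The leaf and the pattern block -/

/-- The walk leaf at digit depth `j`: the non-square test on `X(c)` at `min (N − 2τmax) (j + cZ)` bits. [folklore] -/
def sig2cLeaf (ram : Bool) (N cZ τmax : ℕ) (Z ZT : ℤ × ℤ × ℤ) (c : ℤ) (j : ℕ) : Bool :=
  nonsqT ram N (cX Z ZT c) (min (N - 2 * τmax) (j + cZ))

/-- The odd residues mod 16. [folklore] -/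
def oddRes16 : List ℤ := [1, 3, 5, 7, 9, 11, 13, 15]

/-- The shifts `sh = 2^σ` of the pattern block at exponent `k`: `σ ∈ {1, 2, 3}` with `k + σ` even
(`k + σ = 2·v₂(n)`), and `sh = 0` (`σ ≥ 4`, or `n = 0`). [folklore] -/
def patShifts (k : ℕ) : List ℤ := if k % 2 = 0 then [0, 4] else [0, 2, 8]

/-- `0` is always a shift. [folklore] -/
theorem zero_mem_patShifts (k : ℕ) : (0 : ℤ) ∈ patShifts k := by
  unfold patShifts; split_ifs <;> simp

/-- The pattern block: for every `k ≤ B`, odd `u mod 16` and shift `sh ∈ patShifts k` the class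
`2^k·(u·Z − sh·Z·T)` is certified non-square at `min N (k + 4 + cZ)` bits. [folklore] -/
def sig2cPat (ram : Bool) (N cZ B : ℕ) (Z ZT : ℤ × ℤ × ℤ) : Bool :=
  (List.range (B + 1)).all fun k => oddRes16.all fun u => (patShifts k).all fun sh =>
    nonsqT ram N (cPat Z ZT ((2 : ℤ) ^ k * u) (-((2 : ℤ) ^ k * sh))) (min N (k + 4 + cZ))

/-- An odd integer reduces to a member of `oddRes16`. [folklore] -/
theorem emod16_mem {u : ℤ} (hu : ¬ (2 : ℤ) ∣ u) : u % 16 ∈ oddRes16 := by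
  simp only [oddRes16, List.mem_cons, List.mem_nil_iff, or_false]
  omega

/-- **Pattern contradiction.** If the block passes and `S² ≡ α·Z + β·(Z·T) (mod 2^N)` with `α ≡ 2^k·u`,
`β ≡ −2^k·sh (mod 2^(k+4))`, `k ≤ B`, `u` odd, `sh ∈ patShifts k`, that is absurd. [folklore] -/
theorem pat_contra (ram : Bool) {N cZ B k : ℕ} {Z ZT Zb ZTb S : ℤ × ℤ × ℤ} {u sh α β : ℤ}
    (hpat : sig2cPat ram N cZ B Z ZT = true) (hk : k ≤ B) (hu : ¬ (2 : ℤ) ∣ u) (hsh : sh ∈ patShifts k)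
    (hZ : Z = csc ((2 : ℤ) ^ cZ) Zb) (hZT : ZT = csc ((2 : ℤ) ^ cZ) ZTb)
    (hE : CME ((2 : ℤ) ^ N) (cmul (tm₁ ram) (tm₀ ram) S S) (cPat Z ZT α β))
    (hα : (2 : ℤ) ^ (k + 4) ∣ α - (2 : ℤ) ^ k * u) (hβ : (2 : ℤ) ^ (k + 4) ∣ β + (2 : ℤ) ^ k * sh) : False := by
  have hP := List.all_eq_true.mp (List.all_eq_true.mp (List.all_eq_true.mp hpat k (List.mem_range.mpr (by omega)))
    (u % 16) (emod16_mem hu)) sh hsh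
  refine nonsqT_sound ram N _ _ hP S ?_
  have hα' : (2 : ℤ) ^ (k + 4) ∣ α - (2 : ℤ) ^ k * (u % 16) := by
    obtain ⟨q, hq⟩ : ∃ q : ℤ, u - u % 16 = 16 * q := ⟨u / 16, by omega⟩
    have e : α - 2 ^ k * (u % 16) = (α - 2 ^ k * u) + 2 ^ k * 16 * q := by linear_combination (2 : ℤ) ^ k * hq
    rw [e]; exact dvd_add hα ⟨q, by rw [pow_add]; ring⟩
  have hβ' : (2 : ℤ) ^ (k + 4) ∣ β - -((2 : ℤ) ^ k * sh) := by rwa [sub_neg_eq_add]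
  have hc := cPat_congr hZ hZT hα' hβ'
  exact ((hE.of_dvd (pow_dvd_pow 2 (min_le_left _ _))).trans
    (hc.of_dvd (pow_dvd_pow 2 (by omega))))

/-- **Leaf soundness** for `walk2x`: with `P y` = "some `S'² ≡ X(y) (mod 2^(N − 2τ))` for a `τ ≤ τmax`",
a passing leaf at `(c, j)` refutes every `y ≡ c (mod 2^j)`. [folklore] -/
theorem leaf_sound2c (ram : Bool) {N cZ τmax : ℕ} {Z ZT Zb ZTb : ℤ × ℤ × ℤ} (hZ : Z = csc ((2 : ℤ) ^ cZ) Zb)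
    (hZT : ZT = csc ((2 : ℤ) ^ cZ) ZTb) (c : ℤ) (j : ℕ) (hleaf : sig2cLeaf ram N cZ τmax Z ZT c j = true)
    (y : ℤ) (hy : (2 : ℤ) ^ j ∣ y - c)
    (hP : ∃ τ : ℕ, τ ≤ τmax ∧ ∃ S' : ℤ × ℤ × ℤ, CME ((2 : ℤ) ^ (N - 2 * τ)) (cmul (tm₁ ram) (tm₀ ram) S' S') (cX Z ZT y)) :
    False := by
  obtain ⟨τ, hτ, S', hS'⟩ := hP
  refine nonsqT_sound ram N _ _ hleaf S' ?_
  have hc : CME ((2 : ℤ) ^ (j + cZ)) (cX Z ZT y) (cX Z ZT c) := cPat_congr hZ hZT hy (by simp)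
  exact (hS'.of_dvd (pow_dvd_pow 2 (by omega : min (N - 2 * τmax) (j + cZ) ≤ N - 2 * τ))).trans
    (hc.of_dvd (pow_dvd_pow 2 (min_le_right _ _)))

end Summit.BirchSwinnertonDyer.BirchSwinnertonDyer.Rank2Observatory.TwoDescKill
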